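import Summits.AtomisticToContinuum.BoseEinsteinCondensation.Theorems.BECThomsonPrincipleFibreConductanceStubTransport
import HarnessLib

/-!
# Line `healing-split-kinetic-defect` for crux `FibreConductance` (stmt-AtomisticToContinuum-9480)
# — vocabulary, stub statements and composition (route `BECThomsonPrinciple` Defs-type file, D-0016)

Lead's reshaping (prover-line-stmt-AtomisticToContinuum-9480-c1-0, 2026-08-16) of the planner's
skeleton `Cruxes/FibreConductance/Lines/healing-split-kinetic-defect.lean` onto the LANDED vocabulary of
`Theorems/BECThomsonPrincipleDefs.lean`, closed by the LANDED `stub_transport : GradientCorrectorBound →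
BetaCorrectorBound → FibreConductance` (p88851). The line supplies the GRADIENT CORRECTOR (weak
divergence `ε♭ = gradDefect`) in DUAL FORM and consumes the β-corrector as the shared goal
`BetaCorrectorBound`: (1) `ThomsonRealisation` (`stub_thomson`; new, deterministic) — a dual bound
`‖∫ση‖² ≤ D·∫|∇₀η|²ψ²/W` over `C¹` periodic `η` PRODUCES a measurable flow of `σ` of cost `≤ D`
(Hahn–Banach + Riesz in `L²(cellN; ℂ³)`; the tree has the other half, `norm_pairing_sq_le`), whence
`GradientCorrectorBound ⟸ GradientDualBound`; (2) `TwoScaleSplit` (`stub_twoScaleSplit`; deterministic)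
— block averaging over the `(ν+1)³` cubes of side `ℓ = L/(ν+1)` of the fibre bounds the dual norm of
`ε♭` by `2ℓ²·cageIntegral σ + 12·coarseIntegral κ` for ANY admissible fields of local Poincaré factors,
edge conductances and lattice dual norms (`IsPoincareField`, `IsConductanceField`, `IsLatticeDualField`,
DEFINED by their inequalities — no `⨆` over test functions inside an integral); (3) `KineticBudgetExists`
(`stub_kineticBudget`; provable now); (4) `CageMoments` (`stub_cageMoments`; the cage half at the
healing scale, open); (5) `CoarseScale` (`stub_coarseScale`; coarse cages + beat count with the input at
the minimal strength `ShellOccupation`, open); (6) `stub_shellOccupation = ShellOccupation` and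
(7) `stub_betaCorrector = BetaCorrectorBound` (shared verbatim with the sibling lines).

NOTHING IS ASSERTED here: every `def … : Prop` is a *statement*, consumed only as the type of a stub
theorem or as a hypothesis of the sorry-free composition `FibreConductance_of th kb sp cm cs s b =
stub_transport (gradientCorrectorBound_of_dual th (gradientDualBound_of kb sp cm cs s)) b` (registered
bookkeeping stub `healing_compose`); the stub theorems land one per file under
`Theorems/BECThomsonPrincipleFibreConductance<Stub>.lean` (`--supports` the crux item).

References: the line card `Cruxes/FibreConductance/Lines/healing-split-kinetic-defect.md`; LyonsPeres2016
Ch. 2 (Thomson's principle); GrimmettKestenZhang1993 (flows around sparse bad regions); LSSY2005 Thm. 2.2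
(Dyson's bound); KennedyLiebShastry1988 (occupation bounds).
-/

noncomputable section

namespace Summit.AtomisticToContinuum.BoseEinsteinCondensation.Cruxes.FibreConductance.HealingSplitKineticDefect

open MeasureTheory
open scoped ENNReal
open Literature.MathematicalPhysics.QuantumManyBody.BoseGas
open Summit.AtomisticToContinuum.BoseEinsteinCondensation.Theses.BECThomsonPrinciple (FibreConductance)
open Summit.AtomisticToContinuum.BoseEinsteinCondensation.Cruxes.FibreConductance.ParsevalShellBootstrap

variable {m : ℕ} {L : ℝ}

/-! ## §0 Test functions, dual energy, dual bounds -/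

/-- The unit vector `e_{0,l}` of particle `0`, axis `l`, in configuration space. [folklore] -/
def e0 (m : ℕ) (l : Fin 3) : Config (m + 1) :=
  Pi.single 0 (EuclideanSpace.single l (1 : ℝ))

/-- `C¹` test functions on the `N`-particle torus (periodic in every particle and axis): the class
of `η` in the crux's weak-divergence clause `HasWeakDiv`. [folklore] -/
def IsTest (L : ℝ) (η : Config (m + 1) → ℂ) : Prop :=
  ContDiff ℝ 1 η ∧ ∀ (X : Config (m + 1)) (i : Fin (m + 1)) (l : Fin 3),
    η (X + Pi.single i (EuclideanSpace.single l L)) = η X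

/-- DUAL DIRICHLET ENERGY `E(η) = ∫_{cellN} |∇₀η|² ψ²/W` — the form dual to the cost weight `W/ψ²`
(Disproof §D / `norm_pairing_sq_le` with `w = W/ψ²`). [folklore] -/
def dualEnergy (Φ : PeriodicTrialState (m + 1) L) (η : Config (m + 1) → ℂ) : ℝ≥0∞ :=
  ∫⁻ X in cellN (m + 1) L, ENNReal.ofReal
    ((∑ l : Fin 3, ‖fderiv ℝ η X (e0 m l)‖ ^ 2) * (fibrePsi Φ X ^ 2 / fibreW Φ X))

/-- DUAL BOUND of a charge `σ` at level `B ∈ [0, ∞]`: `‖∫_{cellN} σ η‖² ≤ B · E(η)` for every test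
`η` (the `H⁻¹(ψ²/W)`-norm of `σ`, squared, is `≤ B`; `B = ⊤` is vacuous). By `norm_pairing_sq_le`
every flow of `σ` of cost `≤ B` gives it; `ThomsonRealisation` is the converse. [folklore] -/
def HasDualBound (Φ : PeriodicTrialState (m + 1) L) (σ : Config (m + 1) → ℂ) (B : ℝ≥0∞) : Prop :=
  ∀ η : Config (m + 1) → ℂ, IsTest L η →
    ENNReal.ofReal (‖∫ X in cellN (m + 1) L, σ X * η X‖ ^ 2) ≤ B * dualEnergy Φ η

/-- Dual bounds are monotone in the level. [folklore] -/
theorem HasDualBound.mono {Φ : PeriodicTrialState (m + 1) L} {σ : Config (m + 1) → ℂ} {B B' : ℝ≥0∞}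
    (h : HasDualBound Φ σ B) (hBB' : B ≤ B') : HasDualBound Φ σ B' := fun η hη => (h η hη).trans (by gcongr)

/-- **Statement of `stub_thomson` — THE REALISATION HALF OF THOMSON DUALITY FOR FIBRE FLOWS
(deterministic; M/L; no (H1), no `v`).** For every zero-free periodic `C¹` state `Φ` (`L > 0`),
every continuous charge `σ` and every `D ≥ 0`: a dual bound `‖∫ση‖² ≤ D·∫|∇₀η|²ψ²/W` for all test
`η` yields a MEASURABLE fibre flow `J` with weak divergence `σ` and cost `∫|J|²W/ψ² ≤ D`. Proof: in
`H = L²(cellN; ℂ³)` the functional `√(ψ²/W)∇₀ζ ↦ −∫σ̄ζ` is well defined and bounded by `√D` on its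
domain, extends with the same norm (Hahn–Banach) and is represented by `G`, `‖G‖ ≤ √D` (Riesz);
`J := √(ψ²/W)·G`. With `norm_pairing_sq_le`: `min cost = ‖σ‖²_{H⁻¹(ψ²/W)}` (Thomson's principle for
fibre flows). (Refs: LyonsPeres2016 Ch. 2 §2.4.) -/
def ThomsonRealisation : Prop :=
  ∀ (m : ℕ) (L : ℝ), 0 < L → ∀ Φ : PeriodicTrialState (m + 1) L, (∀ X, Φ.ψ X ≠ 0) →
    ∀ σ : Config (m + 1) → ℂ, Continuous σ → ∀ D : ℝ, 0 ≤ D →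
      HasDualBound Φ σ (ENNReal.ofReal D) →
        ∃ J : Config (m + 1) → (Fin 3 → ℂ), Measurable J ∧ HasWeakDiv L J σ ∧
          fibreCost Φ J ≤ ENNReal.ofReal D

/-- GRADIENT DUAL BOUND (intermediate goal of this line, the dual form of `GradientCorrectorBound`): in
the crux's window the gradient charge `ε♭` has dual bound `‖∫ε♭η‖² ≤ (D L²/‖n‖²)·E(η)`. -/
def GradientDualBound : Prop :=
  LowDensityWindow fun _ L n Φ D =>
    HasDualBound Φ (gradDefect n Φ) (ENNReal.ofReal (D * L ^ 2 / ‖(fun j => (n j : ℝ))‖ ^ 2))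

/-! ## §1 The healing-scale tiling of the fibre and the three admissible fields -/

/-- HEALING-SCALE BLOCK COUNT `ν = ⌊L√(ρ̄a)⌋`, `ρ̄ = N/L³`: the fibre `[0,L)³` is tiled by `(ν+1)³`
cubes of side `ℓ = L/(ν+1)`, so `ℓ²ρ̄a ≤ 1` and `1/ℓ ≤ √(ρ̄a) + 1/L`. [folklore] -/
def healingBlocks (m : ℕ) (L a : ℝ) : ℕ :=
  ⌊L * Real.sqrt (((m + 1 : ℕ) : ℝ) / L ^ 3 * a)⌋₊

/-- Side `ℓ = L/(ν+1)` of the cubes of the tiling with block count `ν`. [folklore] -/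
def side (L : ℝ) (ν : ℕ) : ℝ := L / (ν + 1)

/-- The cube `Q` (multi-index in `(Fin (ν+1))³`) of the tiling of `[0,L)³` into `(ν+1)³` half-open
cubes of side `L/(ν+1)`. [folklore] -/
def cubeSet (L : ℝ) (ν : ℕ) (Q : Fin 3 → Fin (ν + 1)) : Set Space :=
  {y | ∀ l, y l ∈ Set.Ico (((Q l : ℕ) : ℝ) * side L ν) ((((Q l : ℕ) : ℝ) + 1) * side L ν)}

/-- The multi-index of the cube containing `y` (clamped, so that it is defined everywhere; for
`y ∈ [0,L)³` it is `⌊y_l/ℓ⌋`). [folklore] -/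
def cubeIdx (L : ℝ) (ν : ℕ) (y : Space) : Fin 3 → Fin (ν + 1) :=
  fun l => ⟨min ν ⌊y l / side L ν⌋₊, Nat.lt_succ_of_le (min_le_left _ _)⟩

/-- Flat cube average `⨍_Q F(y, X̂) dy` of a function along the `x₀`-fibre through `X`. [folklore] -/
def cubeAvg (L : ℝ) (ν : ℕ) (F : Config (m + 1) → ℂ) (Q : Fin 3 → Fin (ν + 1))
    (X : Config (m + 1)) : ℂ :=
  ((side L ν)⁻¹ ^ 3 : ℝ) • ∫ y in cubeSet L ν Q, F (Function.update X 0 y)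

/-- CUBE CHARGE `c_Q(X̂) = ∫_Q ε♭(y, X̂) dy` of the gradient charge (block-averaged defect as a lattice
charge; `Σ_Q c_Q = ∫_cell ε♭ dy = 0` by fibre-neutrality of `ε♭`). [folklore] -/
def cubeCharge (L : ℝ) (ν : ℕ) (n : Fin 3 → ℤ) (Φ : PeriodicTrialState (m + 1) L)
    (Q : Fin 3 → Fin (ν + 1)) (X : Config (m + 1)) : ℂ :=
  ∫ y in cubeSet L ν Q, gradDefect n Φ (Function.update X 0 y)

/-- Local weighted Dirichlet energy `∫_S Σ_l |∂_{0,l}F(y, X̂)|² ψ(y|X̂)² dy` of a test function over a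
set `S` of the fibre through `X`. [folklore] -/
def locEnergy (Φ : PeriodicTrialState (m + 1) L) (S : Set Space) (F : Config (m + 1) → ℂ)
    (X : Config (m + 1)) : ℝ :=
  ∫ y in S, (∑ l : Fin 3, ‖fderiv ℝ F (Function.update X 0 y) (e0 m l)‖ ^ 2) *
    fibrePsi Φ (Function.update X 0 y) ^ 2

/-- ADMISSIBLE FIELD OF LOCAL POINCARÉ FACTORS at block count `ν`: `σ_Q(X̂) ∈ [0, ∞]`, measurable,
fibre-constant, dominating the local weighted Poincaré ratio of the conditional law on every cube of
every fibre, `∫_Q |F − ⨍_Q F|² ψ² dy ≤ σ_Q(X̂)·ℓ²∫_Q |∇₀F|² ψ² dy` for every test `F` (the least such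
field is the planner's `cubePoincare`; free value `O(1)`; charged only by closed shells). [folklore] -/
def IsPoincareField (L : ℝ) (ν : ℕ) (Φ : PeriodicTrialState (m + 1) L)
    (σ : (Fin 3 → Fin (ν + 1)) → Config (m + 1) → ℝ≥0∞) : Prop :=
  (∀ Q, Measurable (σ Q)) ∧ (∀ Q X y, σ Q (Function.update X 0 y) = σ Q X) ∧
    ∀ (Q : Fin 3 → Fin (ν + 1)) (X : Config (m + 1)) (F : Config (m + 1) → ℂ), IsTest L F →
      ENNReal.ofReal (∫ y in cubeSet L ν Q,
          ‖F (Function.update X 0 y) - cubeAvg L ν F Q X‖ ^ 2 * fibrePsi Φ (Function.update X 0 y) ^ 2) ≤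
        σ Q X * ENNReal.ofReal (side L ν ^ 2 * locEnergy Φ (cubeSet L ν Q) F X)

/-- ADMISSIBLE FIELD OF EDGE CONDUCTANCES at block count `ν`: `g_{Q,l}(X̂) ∈ [0, ∞]`, measurable,
fibre-constant, with `g_{Q,l}(X̂)·|⨍_Q F − ⨍_{Q+e_l} F|² ≤ ∫_{Q ∪ (Q+e_l)} |∇₀F|² ψ² dy` for every test
`F` (periodic cube lattice `(ℤ/(ν+1))³`; the largest such field is the planner's `edgeCond`; free value
`≍ ℓ/L³`; small only across closed shells separating the two cubes). [folklore] -/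
def IsConductanceField (L : ℝ) (ν : ℕ) (Φ : PeriodicTrialState (m + 1) L)
    (g : (Fin 3 → Fin (ν + 1)) → Fin 3 → Config (m + 1) → ℝ≥0∞) : Prop :=
  (∀ Q l, Measurable (g Q l)) ∧ (∀ Q l X y, g Q l (Function.update X 0 y) = g Q l X) ∧
    ∀ (Q : Fin 3 → Fin (ν + 1)) (l : Fin 3) (X : Config (m + 1)) (F : Config (m + 1) → ℂ),
      IsTest L F →
        g Q l X * ENNReal.ofReal (‖cubeAvg L ν F Q X - cubeAvg L ν F (Q + Pi.single l 1) X‖ ^ 2) ≤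
          ENNReal.ofReal (locEnergy Φ (cubeSet L ν Q ∪ cubeSet L ν (Q + Pi.single l 1)) F X)

/-- ADMISSIBLE LATTICE DUAL-NORM FIELD for the cube charges of `ε♭` with conductances `g`: `κ(X̂)`,
measurable, fibre-constant, with `|Σ_Q c_Q(X̂) ā_Q|² ≤ κ(X̂)·Σ_{Q,l} g_{Q,l}(X̂)|a_{Q+e_l} − a_Q|²` for
every lattice potential `a` (the least such `κ` is the planner's `coarseDual`, the squared `H⁻¹` norm of
the cube charges on the random-conductance lattice; finite only for neutral charges). [folklore] -/
def IsLatticeDualField (L : ℝ) (ν : ℕ) (n : Fin 3 → ℤ) (Φ : PeriodicTrialState (m + 1) L)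
    (g : (Fin 3 → Fin (ν + 1)) → Fin 3 → Config (m + 1) → ℝ≥0∞) (κ : Config (m + 1) → ℝ≥0∞) :
    Prop :=
  Measurable κ ∧ (∀ X y, κ (Function.update X 0 y) = κ X) ∧
    ∀ (X : Config (m + 1)) (a : (Fin 3 → Fin (ν + 1)) → ℂ),
      ENNReal.ofReal (‖∑ Q, cubeCharge L ν n Φ Q X * (starRingEnd ℂ) (a Q)‖ ^ 2) ≤
        κ X * ∑ Q, ∑ l : Fin 3, g Q l X * ENNReal.ofReal (‖a (Q + Pi.single l 1) - a Q‖ ^ 2)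

/-- FINE-SCALE CAGE INTEGRAL `∫_{cellN} σ_{Q(x₀)}(X̂) · W |ε♭|²/ψ² dX` of a Poincaré field (bath
expectation of the `σ`-weighted, Lebesgue-weighted density of the gradient charge). [folklore] -/
def cageIntegral (L : ℝ) (ν : ℕ) (σ : (Fin 3 → Fin (ν + 1)) → Config (m + 1) → ℝ≥0∞)
    (n : Fin 3 → ℤ) (Φ : PeriodicTrialState (m + 1) L) : ℝ≥0∞ :=
  ∫⁻ X in cellN (m + 1) L, σ (cubeIdx L ν (X 0)) X *
    ENNReal.ofReal (fibreW Φ X * ‖gradDefect n Φ X‖ ^ 2 / fibrePsi Φ X ^ 2)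

/-- COARSE INTEGRAL `∫_{cellN} |Φ|² κ dX = E_W[κ]` of a (fibre-constant) lattice dual-norm field.
[folklore] -/
def coarseIntegral (Φ : PeriodicTrialState (m + 1) L) (κ : Config (m + 1) → ℝ≥0∞) : ℝ≥0∞ :=
  ∫⁻ X in cellN (m + 1) L, ENNReal.ofReal (‖Φ.ψ X‖ ^ 2) * κ X

/-- FIBRE FISHER INFORMATION `∫_{cellN} W |∇₀ψ|² dX = E_W ∫_cell |∇_yψ|² dy` (`= ∫|∇₀|Φ||² ≤ T(Φ)/N`).
[folklore] -/
def fibreFisher (Φ : PeriodicTrialState (m + 1) L) : ℝ≥0∞ :=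
  ∫⁻ X in cellN (m + 1) L, ENNReal.ofReal (fibreW Φ X * ∑ l : Fin 3, dPsi Φ X l ^ 2)

/-- KINETIC BUDGET at level `(C_F, ρ_F, N_F)` for the potential `v`: exact zero-free minimisers at
density `≤ ρ_F` with `N ≥ N_F` have kinetic energy `T(Φ) ≤ C_F ρ̄ a N` and fibre Fisher information
`∫W|∇₀ψ|² ≤ C_F ρ̄ a` (`a` = scattering length, `ρ̄ = N/L³`). (Refs: LSSY2005, Thm. 2.2 (2.14).) -/
def KineticBudget (v : ℝ → ℝ≥0∞) (C_F ρ_F : ℝ) (N_F : ℕ) : Prop :=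
  ∀ m : ℕ, N_F ≤ m + 1 → ∀ L : ℝ, 0 < L → ((m + 1 : ℕ) : ℝ) ≤ ρ_F * L ^ 3 →
    ∀ Φ : PeriodicTrialState (m + 1) L,
      periodicEnergy v Φ = periodicGroundStateEnergy v (m + 1) L → (∀ X, Φ.ψ X ≠ 0) →
        (∫⁻ X in cellN (m + 1) L, kineticDensity Φ.ψ X) ≤ ENNReal.ofReal
            (C_F * (((m + 1 : ℕ) : ℝ) / L ^ 3) * (scatteringLength v).toReal * (m + 1 : ℕ)) ∧
          fibreFisher Φ ≤
            ENNReal.ofReal (C_F * (((m + 1 : ℕ) : ℝ) / L ^ 3) * (scatteringLength v).toReal)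

/-! ## §2 The statements of the remaining registered stubs -/

/-- **Statement of `stub_twoScaleSplit` — THE TWO-SCALE BLOCK SPLIT (deterministic; L).** For every
zero-free state, block count `ν`, `n ≠ 0` and admissible triple `(σ, g, κ)`:
`‖∫ε♭η‖² ≤ (2ℓ²·cageIntegral σ + 12·coarseIntegral κ)·E(η)` for all test `η` (`ℓ = L/(ν+1)`).
Mechanism: per fibre `η = (η − Πη) + Πη` with the block average `Πη = Σ_Q 1_Q ⨍_Qη`; HIGH part cube by
cube by Cauchy–Schwarz and `IsPoincareField`, then Cauchy–Schwarz over cubes and over the bath with the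
weights `W`, `1/W`; LOW part `∫ε♭Πη dy = Σ_Qc_Q⨍_Qη`, `IsLatticeDualField` with `a_Q = conj ⨍_Qη`,
`IsConductanceField` with `F = η`, each cube on six directed edges ⇒ `≤ 6κ(X̂)∫|∇₀η|²ψ²dy`, Cauchy–Schwarz
over the bath (`∫_{cellN}|Φ|²κ = ∫_{cell^m}Wκ`); `|a+b|² ≤ 2|a|²+2|b|²`. Fubini `cellN = cell × cell^m`:
`lintegral_cellN_eq_fibre_average`. (Refs: GrimmettKestenZhang1993 §2; LyonsPeres2016 Ch. 2 §2.4.) -/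
def TwoScaleSplit : Prop :=
  ∀ (m : ℕ) (L : ℝ), 0 < L → ∀ (ν : ℕ) (n : Fin 3 → ℤ), n ≠ 0 →
    ∀ Φ : PeriodicTrialState (m + 1) L, (∀ X, Φ.ψ X ≠ 0) →
      ∀ (σ : (Fin 3 → Fin (ν + 1)) → Config (m + 1) → ℝ≥0∞)
        (g : (Fin 3 → Fin (ν + 1)) → Fin 3 → Config (m + 1) → ℝ≥0∞) (κ : Config (m + 1) → ℝ≥0∞),
        IsPoincareField L ν Φ σ → IsConductanceField L ν Φ g → IsLatticeDualField L ν n Φ g κ →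
          HasDualBound Φ (gradDefect n Φ)
            (2 * ENNReal.ofReal (side L ν ^ 2) * cageIntegral L ν σ n Φ + 12 * coarseIntegral Φ κ)

/-- **Statement of `stub_kineticBudget` — KINETIC BUDGET (M; provable now).** For bounded repulsive
finite-range `v` there are `C_F ≥ 0`, `ρ_F > 0`, `N_F` with `KineticBudget v C_F ρ_F N_F`. Mechanism:
`W|∇₀ψ|² = |∇₀|Φ||² ≤ |∇₀Φ|²` (diamagnetic; `W` is fibre-constant), Bose symmetry `∫|∇₀Φ|² = T(Φ)/N`,
`T(Φ) ≤ periodicEnergy v Φ = E₀` ((H1)), Dyson's bound `LSSY2005_upperBound_periodic_holds` (PROVED;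
side conditions from `N ≥ N_F`, `ρ̄ ≤ ρ_F`; `N = 1`: `periodicGroundStateEnergy_one`).
(Refs: LSSY2005 Thm. 2.2 (2.14).) -/
def KineticBudgetExists : Prop :=
  ∀ v : ℝ → ℝ≥0∞, IsRepulsiveFiniteRange v → (∃ B : ℝ, ∀ r, v r ≤ ENNReal.ofReal B) →
    ∃ C_F ρ_F : ℝ, 0 ≤ C_F ∧ 0 < ρ_F ∧ ∃ N_F : ℕ, KineticBudget v C_F ρ_F N_F

/-- **Statement of `stub_cageMoments` — CAGE MOMENTS AT THE HEALING SCALE (L/XL; the cage half, fine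
scale; uses (H1); open).** Given the kinetic budget, for every window `M` there are `C₃ ≥ 0`, `ρ₀ > 0`,
`N₀` such that every exact zero-free minimiser in the regime admits an admissible Poincaré field `σ` at
`ν = healingBlocks` (`ℓ²ρ̄a ≤ 1`) with `ℓ²·cageIntegral σ ≤ C₃L²/‖n‖²`. Content: `σ`-weighted,
Lebesgue-weighted local Fisher information of `ψ` (`|ε♭|²/ψ² ≤ 2L⁻³|∇₀ψ|²/(|k|²ψ²) + 2L⁻⁹|β|²/ψ²`)
paid by the kinetic budget up to cluster statistics of the Born law of `Ψ₀` (quantum Ruelle bound) and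
two-sided conditional-density moments; point dips are free, only closed shells inside a healing cube
cost. False for the slab-cage non-minimiser of Disproof §G2. Full discussion: the skeleton
`Cruxes/FibreConductance/Lines/healing-split-kinetic-defect.lean`. (Refs: GrimmettKestenZhang1993 §2;
LSSY2005 Thm. 2.2.) -/
def CageMoments : Prop :=
  ∀ v : ℝ → ℝ≥0∞, IsRepulsiveFiniteRange v → (∃ B : ℝ, ∀ r, v r ≤ ENNReal.ofReal B) →
    ∀ (C_F ρ_F : ℝ) (N_F : ℕ), KineticBudget v C_F ρ_F N_F →
      ∀ M : ℝ, 0 < M → ∃ C₃ : ℝ, 0 ≤ C₃ ∧ ∃ ρ₀ : ℝ, 0 < ρ₀ ∧ ∃ N₀ : ℕ, ∀ m : ℕ, N₀ ≤ m + 1 →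
        ∀ L : ℝ, 0 < L → ((m + 1 : ℕ) : ℝ) ≤ ρ₀ * L ^ 3 → ∀ n : Fin 3 → ℤ, n ≠ 0 →
          2 * Real.pi * ‖(fun j => (n j : ℝ))‖ / L ≤ M * Real.sqrt ((m + 1 : ℕ) / L ^ 3) →
            ∀ Φ : PeriodicTrialState (m + 1) L,
              periodicEnergy v Φ = periodicGroundStateEnergy v (m + 1) L → (∀ X, Φ.ψ X ≠ 0) →
                ∃ σ : (Fin 3 → Fin (healingBlocks m L (scatteringLength v).toReal + 1)) →
                    Config (m + 1) → ℝ≥0∞,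
                  IsPoincareField L (healingBlocks m L (scatteringLength v).toReal) Φ σ ∧
                    ENNReal.ofReal (side L (healingBlocks m L (scatteringLength v).toReal) ^ 2) *
                        cageIntegral L (healingBlocks m L (scatteringLength v).toReal) σ n Φ ≤
                      ENNReal.ofReal (C₃ * L ^ 2 / ‖(fun j => (n j : ℝ))‖ ^ 2)

/-- **Statement of `stub_coarseScale` — THE COARSE SCALE (L/XL; uses (H1); open).** Given the kinetic
budget and the occupation input `ShellOccupation`, for every window `M` there are `C_c ≥ 0`, `ρ₀ > 0`,
`N₀` such that every exact zero-free minimiser in the regime admits an admissible pair `(g, κ)` at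
`ν = healingBlocks` with `coarseIntegral κ ≤ C_cL²/‖n‖²`. Content = the planner's `coarseCages` (the
random-conductance lattice norm of the cube charges is `≤ C ×` the flat one in bath expectation:
sparse bad edges, Grimmett–Kesten–Zhang detours; open) + `beatCount` (flat norm diagonal in lattice
Fourier modes; aliased modes paid by the flat Fisher budget, non-resonant modes by `Σn_p = N`, the
resonant beat shell by `ShellOccupation` and the lattice count — bookkeeping, cf. the landed
`stub_parsevalShell`; the `β/L³` term of `ε♭` is constant in `y` and drops out of every `P̃ ≠ 0` mode,
so no structure factor is needed). False without (H1) (Disproof §G2 slab). Full discussion: the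
skeleton file. (Refs: GrimmettKestenZhang1993 Thm. 1, §2; KennedyLiebShastry1988; LSSY2005 §1.2.) -/
def CoarseScale : Prop :=
  ∀ v : ℝ → ℝ≥0∞, IsRepulsiveFiniteRange v → (∃ B : ℝ, ∀ r, v r ≤ ENNReal.ofReal B) →
    ∀ (C_F ρ_F : ℝ) (N_F : ℕ), KineticBudget v C_F ρ_F N_F → ShellOccupation →
      ∀ M : ℝ, 0 < M → ∃ C_c : ℝ, 0 ≤ C_c ∧ ∃ ρ₀ : ℝ, 0 < ρ₀ ∧ ∃ N₀ : ℕ, ∀ m : ℕ, N₀ ≤ m + 1 →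
        ∀ L : ℝ, 0 < L → ((m + 1 : ℕ) : ℝ) ≤ ρ₀ * L ^ 3 → ∀ n : Fin 3 → ℤ, n ≠ 0 →
          2 * Real.pi * ‖(fun j => (n j : ℝ))‖ / L ≤ M * Real.sqrt ((m + 1 : ℕ) / L ^ 3) →
            ∀ Φ : PeriodicTrialState (m + 1) L,
              periodicEnergy v Φ = periodicGroundStateEnergy v (m + 1) L → (∀ X, Φ.ψ X ≠ 0) →
                ∃ (g : (Fin 3 → Fin (healingBlocks m L (scatteringLength v).toReal + 1)) → Fin 3 →
                      Config (m + 1) → ℝ≥0∞) (κ : Config (m + 1) → ℝ≥0∞),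
                  IsConductanceField L (healingBlocks m L (scatteringLength v).toReal) Φ g ∧
                    IsLatticeDualField L (healingBlocks m L (scatteringLength v).toReal) n Φ g κ ∧
                      coarseIntegral Φ κ ≤ ENNReal.ofReal (C_c * L ^ 2 / ‖(fun j => (n j : ℝ))‖ ^ 2)

/-! ### Audit names of the stub statements (`Goal.stub_x` = statement of the registered `stub_x`) -/

namespace Goal

/-- Statement of `stub_thomson`. -/
abbrev stub_thomson : Prop := ThomsonRealisation
/-- Statement of `stub_kineticBudget`. -/
abbrev stub_kineticBudget : Prop := KineticBudgetExists
/-- Statement of `stub_twoScaleSplit`. -/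
abbrev stub_twoScaleSplit : Prop := TwoScaleSplit
/-- Statement of `stub_cageMoments`. -/
abbrev stub_cageMoments : Prop := CageMoments
/-- Statement of `stub_coarseScale`. -/
abbrev stub_coarseScale : Prop := CoarseScale
/-- Statement of `stub_shellOccupation` (verbatim the shared `ShellOccupation`). -/
abbrev stub_shellOccupation : Prop := ShellOccupation
/-- Statement of `stub_betaCorrector` (verbatim the shared goal `BetaCorrectorBound`). -/
abbrev stub_betaCorrector : Prop := BetaCorrectorBound

end Goal

/-! ## §3 Glue (proved) -/

/-- The gradient charge `ε♭` of a zero-free state is continuous (`L > 0`). [folklore] -/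
theorem continuous_gradDefect (hL : 0 < L) (n : Fin 3 → ℤ) (Φ : PeriodicTrialState (m + 1) L)
    (hΦ : ∀ X, Φ.ψ X ≠ 0) : Continuous (gradDefect n Φ) := by
  have hphase : Continuous (phase L n) := (contDiff_phase L n (k := 0)).continuous
  have hd : ∀ l : Fin 3, Continuous fun X => dPsi Φ X l := continuous_dPsi hL Φ hΦ
  have hβc := continuous_fibreBeta hL n Φ hΦ
  unfold gradDefect
  fun_prop

/-- **Dual form ⇒ flow form for the gradient corrector**: Thomson realisation turns
`GradientDualBound` into `GradientCorrectorBound` (same `ρ₀, D, N₀`). [folklore] -/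
theorem gradientCorrectorBound_of_dual (th : ThomsonRealisation) (hd : GradientDualBound) :
    GradientCorrectorBound := by
  intro v hv hB M hM
  obtain ⟨ρ₀, D, hρ₀, hD, N₀, h⟩ := hd v hv hB M hM
  refine ⟨ρ₀, D, hρ₀, hD, N₀, fun m hm L hL hρ n hn hw Φ hE hz => ?_⟩
  exact th m L hL Φ hz (gradDefect n Φ) (continuous_gradDefect hL n Φ hz) _ (by positivity)
    (h m hm L hL hρ n hn hw Φ hE hz)

/-- `ℝ≥0∞` bookkeeping: `2a + 12b ≤ (2A + 12B + 1)x` when `a ≤ Ax`, `b ≤ Bx`. [folklore] -/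
theorem two_mul_add_twelve_mul_le {a b A B x : ℝ≥0∞} (ha : a ≤ A * x) (hb : b ≤ B * x) :
    2 * a + 12 * b ≤ (2 * A + 12 * B + 1) * x := by
  calc 2 * a + 12 * b ≤ 2 * (A * x) + 12 * (B * x) := by gcongr
    _ = (2 * A + 12 * B) * x := by ring
    _ ≤ (2 * A + 12 * B + 1) * x := mul_le_mul_of_nonneg_right le_self_add bot_le

/-- **The dual bound of the gradient charge from the split and the two scale stubs** (`ρ₀ = min`,
`N₀ = max`, `D = 2C₃ + 12C_c + 1`; at every datum the split at `ν = healingBlocks` with the two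
admissible fields gives `‖∫ε♭η‖² ≤ (2ℓ²cage + 12coarse)E(η) ≤ D(L²/‖n‖²)E(η)`). [folklore] -/
theorem gradientDualBound_of (kb : KineticBudgetExists) (sp : TwoScaleSplit) (cm : CageMoments)
    (cs : CoarseScale) (s : ShellOccupation) : GradientDualBound := by
  intro v hv hB M hM
  obtain ⟨C_F, ρ_F, _, _, N_F, hKB⟩ := kb v hv hB
  obtain ⟨C₃, hC₃, ρ₄, hρ₄, N₄, H4⟩ := cm v hv hB C_F ρ_F N_F hKB M hM
  obtain ⟨C_c, hCc, ρ₅, hρ₅, N₅, H5⟩ := cs v hv hB C_F ρ_F N_F hKB s M hM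
  refine ⟨min ρ₄ ρ₅, 2 * C₃ + 12 * C_c + 1, lt_min hρ₄ hρ₅, by positivity, max N₄ N₅, ?_⟩
  intro m hm L hL hρ n hn hw Φ hE hz
  have hL3 : (0 : ℝ) ≤ L ^ 3 := by positivity
  have hρ4' : ((m + 1 : ℕ) : ℝ) ≤ ρ₄ * L ^ 3 :=
    hρ.trans (mul_le_mul_of_nonneg_right (min_le_left _ _) hL3)
  have hρ5' : ((m + 1 : ℕ) : ℝ) ≤ ρ₅ * L ^ 3 :=
    hρ.trans (mul_le_mul_of_nonneg_right (min_le_right _ _) hL3)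
  have hm4 : N₄ ≤ m + 1 := le_trans (le_max_left _ _) hm
  have hm5 : N₅ ≤ m + 1 := le_trans (le_max_right _ _) hm
  obtain ⟨σ, hσ, hcage⟩ := H4 m hm4 L hL hρ4' n hn hw Φ hE hz
  obtain ⟨g, κ, hg, hκ, hcoarse⟩ := H5 m hm5 L hL hρ5' n hn hw Φ hE hz
  set x : ℝ := L ^ 2 / ‖(fun j => (n j : ℝ))‖ ^ 2 with hx
  have hx0 : 0 ≤ x := by positivity
  have hsplit := sp m L hL _ n hn Φ hz σ g κ hσ hg hκ
  refine hsplit.mono ?_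
  have hcage' : ENNReal.ofReal (side L (healingBlocks m L (scatteringLength v).toReal) ^ 2) *
      cageIntegral L _ σ n Φ ≤ ENNReal.ofReal C₃ * ENNReal.ofReal x := by
    rw [← ENNReal.ofReal_mul hC₃]; simpa [hx, mul_div_assoc] using hcage
  have hcoarse' : coarseIntegral Φ κ ≤ ENNReal.ofReal C_c * ENNReal.ofReal x := by
    rw [← ENNReal.ofReal_mul hCc]; simpa [hx, mul_div_assoc] using hcoarse
  calc 2 * ENNReal.ofReal (side L (healingBlocks m L (scatteringLength v).toReal) ^ 2) *
          cageIntegral L _ σ n Φ + 12 * coarseIntegral Φ κ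
      ≤ (2 * ENNReal.ofReal C₃ + 12 * ENNReal.ofReal C_c + 1) * ENNReal.ofReal x := by
        rw [mul_assoc]
        exact two_mul_add_twelve_mul_le hcage' hcoarse'
    _ = ENNReal.ofReal ((2 * C₃ + 12 * C_c + 1) * x) := by
        rw [ENNReal.ofReal_mul (by positivity)]
        congr 1
        rw [ENNReal.ofReal_add (by positivity) zero_le_one, ENNReal.ofReal_add (by positivity)
          (by positivity), ENNReal.ofReal_mul zero_le_two, ENNReal.ofReal_mul (by norm_num),
          ENNReal.ofReal_one, ENNReal.ofReal_ofNat, ENNReal.ofReal_ofNat]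
    _ = ENNReal.ofReal ((2 * C₃ + 12 * C_c + 1) * L ^ 2 / ‖(fun j => (n j : ℝ))‖ ^ 2) := by
        rw [hx, mul_div_assoc]

/-! ## §5 Composition (sorry-free): the seven stubs give the crux BY NAME -/

/-- **`FibreConductance` from the seven stubs.** The kinetic budget, the split and the two scale
stubs (with the occupation input) give the dual bound of the gradient charge (`gradientDualBound_of`);
Thomson realisation turns it into the gradient corrector (`gradientCorrectorBound_of_dual`); the
landed transport reduction `stub_transport` glues it with the β-corrector. [folklore] -/
theorem FibreConductance_of (th : Goal.stub_thomson) (kb : Goal.stub_kineticBudget)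
    (sp : Goal.stub_twoScaleSplit) (cm : Goal.stub_cageMoments) (cs : Goal.stub_coarseScale)
    (s : Goal.stub_shellOccupation) (b : Goal.stub_betaCorrector) : FibreConductance :=
  stub_transport (gradientCorrectorBound_of_dual th (gradientDualBound_of kb sp cm cs s)) b

/-- Statement of the bookkeeping stub `healing_compose`: the seven stub statements imply the crux
`FibreConductance` BY NAME (registered so that this shared vocabulary file lands as a `--supports`
file of stmt-AtomisticToContinuum-9480; precedents `ParsevalShellBootstrap.stub_compose`,
`BECConjugateDominationDefs.stub_imuOfParts`). -/
abbrev Goal.healing_compose : Prop :=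
  Goal.stub_thomson → Goal.stub_kineticBudget → Goal.stub_twoScaleSplit → Goal.stub_cageMoments →
    Goal.stub_coarseScale → Goal.stub_shellOccupation → Goal.stub_betaCorrector → FibreConductance

/-- **The registered bookkeeping stub `healing_compose`, proved** (`= FibreConductance_of`). [folklore] -/
theorem healing_compose : Goal.healing_compose :=
  FibreConductance_of

end Summit.AtomisticToContinuum.BoseEinsteinCondensation.Cruxes.FibreConductance.HealingSplitKineticDefect

end
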